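/-
Copyright (c) 2026 the pub-hodgecm-mathlib formalisation cell (harness21).  Prover seat hodgecm-mathlib-K2E4-p07 (g0),
Track B «K2-LIT» ∕ h413, unit «FinGermConstants» of the line `K2_E4_SingularTransferKappaSign`, socket #7R
`K2E4SingularTransferKappaSign.FinGermConstants.sig_K2E3GermConstantRegularHR` (ED. 3), SPLIT PLACES: the named split transfer `cmSplitTransfer` of the indicator of a
`GL₃(𝒪_w)`-double coset CHARGES every point of `H_v`.  2026-09-03.
-/
import Literature.NumberTheory.Rogawski1990.TamagawaSingularMembersFinTFCovol     -- ★ p844690: the letters' FRAME (`CanonicalTransferMatrix`, `ArchCanonicalSingularMatrix`, binders byte-for-byte)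
import Literature.NumberTheory.Rogawski1990.FinExplicitTransferFactorConjLeft     -- ★ `finExplicitDelta_conj_left_all`
import Literature.NumberTheory.Rogawski1990.FinExplicitTransferFactorConjRight    -- ★ `finExplicitDelta_conj_right_all`
import Literature.NumberTheory.Rogawski1990.ArchCanonicalTransferFactor           -- ★ `archCanonicalTransferFactor` (the pinned `Tinf`)
import Literature.NumberTheory.Automorphic.QuadraticHeckeCharacterCM              -- ★ `quadraticHeckeCharCM`
import Literature.NumberTheory.Rogawski1990.SmoothTransferSplitPlaceNamed         -- ★ `isLocalDeltaTransfer_cmSplitTransfer` and the whole split-place frame (`cmSplitTransfer`, `splitKUMeasure`, …)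
import Literature.NumberTheory.Rogawski1990.GRegularLocalisation                        -- ★ `isLocalGRegular_out_mk_rationalComponent`
import Literature.MeasureTheory.Group.RightInvariantIsHaar                                -- ★ `isHaarMeasure_of_isMulRightInvariant_of_ne_zero`
import Summits.HodgeConjecture.HodgeConjecture.Theorems.K2E4WeakMatrixAlmostEverywhereAgreementUnitTransfer   -- ★ `isMulRightInvariant_endoscopicLocal` (H_v unimodular)
import Summits.HodgeConjecture.HodgeConjecture.Theorems.K2E4WeakMatrixAlmostEverywhereAgreementRationalPair   -- ★ `exists_isGRegular_isNormPair`
import HarnessLib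

/-!
# K2_E4 road (h413 = stmt-HodgeConjecture-24833), socket #7R `sig_K2E3GermConstantRegularHR` at a SPLIT place:
# `cmSplitTransfer(1_{e′⁻¹(K m_z K)})(z) ≠ 0` for every `z ∈ H_v` (`K = GL₃(𝒪_w)`, `m_z = diag(e₂ z.1, e₁ z.2)`)

Cell `pub/hodgecm-mathlib` (D-0151), Track B; socket **`sig_K2E3GermConstantRegularHR`** (FinGermConstants ED. 3, R-twin of #7; OWNER K2E3, base K2E4-p07).  Dealer word
(K2E4-plan 21:26:21Z) «split part ⟸ the named split transfer»; K2E4-p01 21:35:43Z «#7′ at SPLIT v is now a short assembly».  THIS FILE is the VALUE at an ARBITRARY point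
`z ∈ H_v` of the named split transfer ★ `UnitaryGroup.cmSplitTransfer … f` ([Rogawski1990, Lemma 4.13.1 (a)]: `f ↦ (νG(K′)∕νH(K_H)) · μ_w(det e₂ h.1) · f̄^P(h)`,
`f̄^P(h) = δ_P(m_h)^{1∕2} ∫_{K × U} f(e′⁻¹(k m_h u k⁻¹))`, `K = GL₃(𝒪_w)`, `U = U_{(2,1)}`, ★ `UnitaryGroupConstantTermSplit`) on ONE well-chosen test function:
`f := 1_{e′⁻¹ D}`, `D := K · m_z · K` the `K`-double coset of `m_z = diag(e₂ z.1, e₁ z.2)` (compact, open).  Since `D` is `K`-bi-invariant the integrand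
`1_D(k m_z u k⁻¹) = 1_D(m_z u)` does not see `k`, and `{u ∈ U | m_z u ∈ D} ⊇ U ∩ K` has `μ_U`-mass `≥ μ_U(U ∩ K) = 1` (and `< ∞`: it is compact), so
`f̄^P(z) = δ^{1∕2} · κ(K) · μ_U(T) ≠ 0`; the prefactors `νG(K′)∕νH(K_H)` (both compact open subgroups: `0 < · < ∞`), `μ_w(·) ∈ ℂˣ`, `δ^{1∕2} ∈ ℂˣ` are non-zero.
With ★ `isLocalDeltaTransfer_cmSplitTransfer` (the named transfer IS a `Δ‴_v`-transfer for canonical `mH`, `mG`) this pays `sig_K2E3GermConstantRegularHR` at every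
SPLIT `v` (in or out of `S_bad`, `e₁` integral or not) — the frame assembly is `germConstantRegularHR_of_not_subsingleton` (§3).

* §1 `prefactor_ne_zero` — `νG(K′).toReal ∕ νH(K_H).toReal ≠ 0` (`K′ = e′⁻¹K`, `K_H = j̃⁻¹(M ∩ K)` compact open subgroups; the `j̃ : H_v ≃ₜ* M_{(2,1)}` of ★ B5).
* §2 **`exists_isLocSmooth_cmSplitTransfer_apply_ne_zero`** — `∀ z, ∃ f ∈ C_c^∞(G′_v), cmSplitTransfer … f z ≠ 0`.
* §3 **`germConstantRegularHR_of_not_subsingleton`** — #7R's binders TOKEN FOR TOKEN, conclusion guarded by `¬ Subsingleton (PlacesOver L v)` (split `v`).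

HONEST LABEL: HC_CM is proved only modulo the 7 printed citations (2 remaining named inputs: hLiu418 = stmt-HodgeConjecture-24832, h413 =
stmt-HodgeConjecture-24833) until rung 0 closes; this file is a `--supports stmt-HodgeConjecture-24833` helper; with ★ `K2E3GermConstantRegularHUnitPair` it leaves of
#7R exactly the non-split `v ∈ S_bad` (★ `K2E3GermConstantRegularHRLocalReduction` + `…DescentValue` pre-pay that residue's generic parts).
-/

set_option autoImplicit false
set_option linter.dupNamespace false

noncomputable section

open MeasureTheory Measure NumberField IsDedekindDomain TopologicalSpace
open Literature.MeasureTheory.Group Literature.MeasureTheory.RestrictedProduct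
open Literature.Topology.RestrictedProduct Literature.Topology.Algebra.RestrictedProduct
open Literature.NumberTheory.Rogawski1990 Literature.NumberTheory.Automorphic Literature.NumberTheory.GaloisRepresentations
open Literature.AlgebraicGeometry.ShimuraVarieties (unitaryGroup hermForm)
open scoped Matrix MatrixGroups NNReal ENNReal Pointwise

namespace Summit.HodgeConjecture.HodgeConjecture.Cruxes.H413.K2E3GermConstantRegularHRSplit

section Value

open Literature.NumberTheory.Automorphic.UnitaryGroup

variable (L : Type) [Field L] [NumberField L] [IsCMField L] (H' : Matrix (Fin 3) (Fin 3) L)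
  (hH' : (H'.map (cmConjRingHom L))ᵀ = H') (hH'd : IsUnit H'.det)
  (v : HeightOneSpectrum (𝓞 ↥(maximalRealSubfield L))) (w : PlacesOver L v) (hw : IsCMField.complexConj L • w.1 ≠ w.1)
  [MeasurableSpace ((UnitaryGroup.cmDatum L 2 (Matrix.of fun i j : Fin 2 => if i.val + j.val + 1 = 2 then (1 : L) else 0)).Local v × (UnitaryGroup.cmDatum L 1 (Matrix.of fun i j : Fin 1 => if i.val + j.val + 1 = 1 then (1 : L) else 0)).Local v)]
  [MeasurableSpace ((UnitaryGroup.cmDatum L 3 H').Local v)]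
  (νH : Measure ((UnitaryGroup.cmDatum L 2 (Matrix.of fun i j : Fin 2 => if i.val + j.val + 1 = 2 then (1 : L) else 0)).Local v × (UnitaryGroup.cmDatum L 1 (Matrix.of fun i j : Fin 1 => if i.val + j.val + 1 = 1 then (1 : L) else 0)).Local v)) [νH.IsHaarMeasure]
  (νG : Measure ((UnitaryGroup.cmDatum L 3 H').Local v)) [νG.IsHaarMeasure]

/-! ## §1  The prefactor `νG(K′) ∕ νH(K_H)` is non-zero -/

include hw in
/-- **`0 < νG(K′) < ∞` and `0 < νH(K_H) < ∞`, hence `νG(K′).toReal ∕ νH(K_H).toReal ≠ 0`**: `K′ = e′⁻¹ GL₃(𝒪_w)` (★ `cmSplitMaxCompact`) and `K_H = {h | diag(e₂ h.1, e₁ h.2) ∈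
GL₃(𝒪_w)}` (★ `cmSplitLeviCompact`) are compact open subgroups (the latter read through the two-block Levi model `j̃ : H_v ≃ₜ* M_{(2,1)}`, ★
`exists_continuousMulEquiv_prod_standardLeviGL_twoBlock`, exactly as in ★ `isLocalDeltaTransfer_cmSplitTransfer`). [cite: Rogawski1990, §4.4 p. 44; §4.13 p. 64] -/
theorem prefactor_ne_zero :
    ((νG (cmSplitMaxCompact L v w hw H' hH' hH'd)).toReal / (νH (cmSplitLeviCompact L v w hw)).toReal : ℝ) ≠ 0 := by
  -- `K′`
  set e' := localSplitEquiv (IsCMField.complexConj L) H' (IsCMField.complexConj_ne_one L)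
      ((map_cmConjRingHom_eq_map_complexConj L H') ▸ hH') w hw (isUnit_placeForm_of_isUnit_det hH'd w.1) with he'
  have hKGset : (cmSplitMaxCompact L v w hw H' hH' hH'd : Set ((UnitaryGroup.cmDatum L 3 H').Local v)) =
      e' ⁻¹' (glInt 3 (w.1.adicCompletion L) : Set (GL (Fin 3) (w.1.adicCompletion L))) := rfl
  have hKG0 : νG (cmSplitMaxCompact L v w hw H' hH' hH'd) ≠ 0 := by
    have hopen : IsOpen (cmSplitMaxCompact L v w hw H' hH' hH'd : Set ((UnitaryGroup.cmDatum L 3 H').Local v)) := by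
      rw [hKGset]; exact (isOpen_glInt 3 (w.1.adicCompletion L)).preimage e'.continuous
    exact (hopen.measure_pos νG ⟨1, (cmSplitMaxCompact L v w hw H' hH' hH'd).one_mem⟩).ne'
  have hKGt : νG (cmSplitMaxCompact L v w hw H' hH' hH'd) ≠ ⊤ := by
    have hcpt : IsCompact (cmSplitMaxCompact L v w hw H' hH' hH'd : Set ((UnitaryGroup.cmDatum L 3 H').Local v)) := by
      rw [hKGset]; exact e'.toHomeomorph.isCompact_preimage.2 (isCompact_glInt 3 (w.1.adicCompletion L))
    exact hcpt.measure_lt_top.ne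
  -- `K_H` through the Levi model
  obtain ⟨eM, heM⟩ := exists_continuousMulEquiv_prod_standardLeviGL_twoBlock (w.1.adicCompletion L) 2 1
  have hMc : IsClosed ((standardLeviGL (w.1.adicCompletion L) (fun i : Fin (2 + 1) => decide (2 ≤ (i : ℕ))) :
      Subgroup (GL (Fin (2 + 1)) (w.1.adicCompletion L))) : Set (GL (Fin (2 + 1)) (w.1.adicCompletion L))) :=
    isClosed_standardLeviGL (R := w.1.adicCompletion L) _
  let jj : ((UnitaryGroup.cmDatum L 2 (Matrix.of fun i j : Fin 2 => if i.val + j.val + 1 = 2 then (1 : L) else 0)).Local v × (UnitaryGroup.cmDatum L 1 (Matrix.of fun i j : Fin 1 => if i.val + j.val + 1 = 1 then (1 : L) else 0)).Local v) ≃ₜ* ↥(standardLeviGL (w.1.adicCompletion L) (fun i : Fin (2 + 1) => decide (2 ≤ (i : ℕ)))) :=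
    { toMulEquiv := (MulEquiv.prodCongr (cmSplitEquivTwo L v w hw).toMulEquiv (cmSplitEquivOne L v w hw).toMulEquiv).trans eM.toMulEquiv
      continuous_toFun := eM.continuous.comp ((cmSplitEquivTwo L v w hw).continuous.prodMap (cmSplitEquivOne L v w hw).continuous)
      continuous_invFun := ((cmSplitEquivTwo L v w hw).symm.continuous.prodMap (cmSplitEquivOne L v w hw).symm.continuous).comp eM.symm.continuous }
  have hjjGL : ∀ x, ((jj x : ↥(standardLeviGL (w.1.adicCompletion L) (fun i : Fin (2 + 1) => decide (2 ≤ (i : ℕ))))) : GL (Fin (2 + 1)) (w.1.adicCompletion L)) =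
      cmSplitLeviGL L v w hw x := fun x => by
    show ((eM (cmSplitEquivTwo L v w hw x.1, cmSplitEquivOne L v w hw x.2) : ↥(standardLeviGL (w.1.adicCompletion L) (fun i : Fin (2 + 1) => decide (2 ≤ (i : ℕ))))) :
      GL (Fin (2 + 1)) (w.1.adicCompletion L)) = _
    rw [heM, cmSplitLeviGL_apply]
  have hKHset : (cmSplitLeviCompact L v w hw : Set ((UnitaryGroup.cmDatum L 2 (Matrix.of fun i j : Fin 2 => if i.val + j.val + 1 = 2 then (1 : L) else 0)).Local v × (UnitaryGroup.cmDatum L 1 (Matrix.of fun i j : Fin 1 => if i.val + j.val + 1 = 1 then (1 : L) else 0)).Local v)) =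
      jj ⁻¹' (((↑) : ↥(standardLeviGL (w.1.adicCompletion L) (fun i : Fin (2 + 1) => decide (2 ≤ (i : ℕ)))) → GL (Fin (2 + 1)) (w.1.adicCompletion L)) ⁻¹'
        (glInt (2 + 1) (w.1.adicCompletion L) : Set (GL (Fin (2 + 1)) (w.1.adicCompletion L)))) := by
    ext x
    simp only [SetLike.mem_coe, mem_cmSplitLeviCompact_iff, Set.mem_preimage, hjjGL]
  have hKH0 : νH (cmSplitLeviCompact L v w hw) ≠ 0 := by
    have hopen : IsOpen (cmSplitLeviCompact L v w hw : Set ((UnitaryGroup.cmDatum L 2 (Matrix.of fun i j : Fin 2 => if i.val + j.val + 1 = 2 then (1 : L) else 0)).Local v × (UnitaryGroup.cmDatum L 1 (Matrix.of fun i j : Fin 1 => if i.val + j.val + 1 = 1 then (1 : L) else 0)).Local v)) := by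
      rw [hKHset]
      exact ((isOpen_glInt (2 + 1) (w.1.adicCompletion L)).preimage continuous_subtype_val).preimage jj.continuous
    exact (hopen.measure_pos νH ⟨1, (cmSplitLeviCompact L v w hw).one_mem⟩).ne'
  have hKHt : νH (cmSplitLeviCompact L v w hw) ≠ ⊤ := by
    have hcpt : IsCompact (cmSplitLeviCompact L v w hw : Set ((UnitaryGroup.cmDatum L 2 (Matrix.of fun i j : Fin 2 => if i.val + j.val + 1 = 2 then (1 : L) else 0)).Local v × (UnitaryGroup.cmDatum L 1 (Matrix.of fun i j : Fin 1 => if i.val + j.val + 1 = 1 then (1 : L) else 0)).Local v)) := by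
      rw [hKHset]
      exact jj.toHomeomorph.isCompact_preimage.2 (hMc.isClosedEmbedding_subtypeVal.isCompact_preimage (isCompact_glInt (2 + 1) (w.1.adicCompletion L)))
    exact hcpt.measure_lt_top.ne
  exact div_ne_zero (ENNReal.toReal_ne_zero.2 ⟨hKG0, hKGt⟩) (ENNReal.toReal_ne_zero.2 ⟨hKH0, hKHt⟩)

/-! ## §2  The value of the named split transfer at `z` on the indicator of the double coset `K · m_z · K` -/

include hw in
/-- **`cmSplitTransfer(1_{e′⁻¹(K m_z K)})(z) ≠ 0`.**  With `K = GL₃(𝒪_w)`, `m_z = diag(e₂ z.1, e₁ z.2)` (★ `cmSplitLeviGL`) and `D := K·m_z·K` (compact open, `K`-bi-invariant),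
the test function `f := 1_D ∘ e′` is in `C_c^∞(G′_v)` and `f̄^P(z) = δ_P(m_z)^{1∕2} · ∫_{K×U} 1_D(k m_z u k⁻¹) = δ^{1∕2} · κ(K) · μ_U{u | m_z u ∈ D}` with `κ(K) = 1` and
`μ_U{u | m_z u ∈ D} ≥ μ_U(U ∩ K) = 1` (★ `splitKUMeasure`'s normalisations), finite since that set is compact; the prefactors are non-zero (§1, `μ_w(·) ∈ ℂˣ`, `δ ∈ ℂˣ`).
[cite: Rogawski1990, §4.13 Lemma 4.13.1 (a) pp. 64–66; §4.4 p. 44] -/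
theorem exists_isLocSmooth_cmSplitTransfer_apply_ne_zero (μ : HeckeCharacter L) (z : ((UnitaryGroup.cmDatum L 2 (Matrix.of fun i j : Fin 2 => if i.val + j.val + 1 = 2 then (1 : L) else 0)).Local v × (UnitaryGroup.cmDatum L 1 (Matrix.of fun i j : Fin 1 => if i.val + j.val + 1 = 1 then (1 : L) else 0)).Local v)) :
    ∃ f : ((UnitaryGroup.cmDatum L 3 H').Local v) → ℂ, IsLocSmooth f ∧ cmSplitTransfer L H' hH' hH'd v w hw μ νH νG f z ≠ 0 := by
  classical
  -- (0) instances on `GL₃(L_w)`, `K`, `U` (as in ★ B5)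
  letI : MeasurableSpace (GL (Fin 3) (w.1.adicCompletion L)) := borel _
  haveI : BorelSpace (GL (Fin 3) (w.1.adicCompletion L)) := ⟨rfl⟩
  haveI : LocallyCompactSpace (GL (Fin 3) (w.1.adicCompletion L)) := locallyCompactSpace_gl_adicCompletion L 3 w.1
  haveI : SecondCountableTopology (GL (Fin 3) (w.1.adicCompletion L)) := secondCountableTopology_gl_adicCompletion L 3 w.1
  haveI : BorelSpace ↥(glInt 3 (w.1.adicCompletion L)) := Subtype.borelSpace _
  haveI : CompactSpace ↥(glInt 3 (w.1.adicCompletion L)) := isCompact_iff_compactSpace.1 (isCompact_glInt 3 (w.1.adicCompletion L))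
  have hUc : IsClosed (unipotentRadicalGL (w.1.adicCompletion L) (Zelevinsky1980.lastBlockLabel 3) : Set (GL (Fin 3) (w.1.adicCompletion L))) :=
    isClosed_unipotentRadicalGL (R := w.1.adicCompletion L) (Zelevinsky1980.lastBlockLabel 3)
  haveI : BorelSpace ↥(unipotentRadicalGL (w.1.adicCompletion L) (Zelevinsky1980.lastBlockLabel 3)) := Subtype.borelSpace _
  haveI : LocallyCompactSpace ↥(unipotentRadicalGL (w.1.adicCompletion L) (Zelevinsky1980.lastBlockLabel 3)) :=
    hUc.isClosedEmbedding_subtypeVal.locallyCompactSpace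
  haveI : SecondCountableTopology ↥(unipotentRadicalGL (w.1.adicCompletion L) (Zelevinsky1980.lastBlockLabel 3)) :=
    TopologicalSpace.Subtype.secondCountableTopology _
  obtain ⟨κ, hκ⟩ : ∃ κ : Measure ↥(glInt 3 (w.1.adicCompletion L)), κ = haarMeasure (glIntPositiveCompacts (w.1.adicCompletion L)) := ⟨_, rfl⟩
  haveI : IsHaarMeasure κ := by rw [hκ]; exact isHaarMeasure_haarMeasure _
  obtain ⟨μU, hμU⟩ : ∃ μU : Measure ↥(unipotentRadicalGL (w.1.adicCompletion L) (Zelevinsky1980.lastBlockLabel 3)),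
      μU = haarMeasure (unipotentIntPositiveCompacts (w.1.adicCompletion L)) := ⟨_, rfl⟩
  haveI : IsHaarMeasure μU := by rw [hμU]; exact isHaarMeasure_haarMeasure _
  haveI : SFinite μU := inferInstance
  have hKU : splitKUMeasure (w.1.adicCompletion L) = κ.prod μU := by rw [hκ, hμU]; rfl
  have hκ1 : κ Set.univ = 1 := by rw [hκ]; exact haarMeasure_self
  -- (1) the Levi point `m_z`, the double coset `D = K m_z K`
  set m₀ : GL (Fin 3) (w.1.adicCompletion L) := cmSplitLeviGL L v w hw z with hm₀
  set K₃ : Set (GL (Fin 3) (w.1.adicCompletion L)) := (glInt 3 (w.1.adicCompletion L) : Set (GL (Fin 3) (w.1.adicCompletion L))) with hK₃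
  set D : Set (GL (Fin 3) (w.1.adicCompletion L)) := K₃ * ({m₀} * K₃) with hD
  have hDc : IsCompact D := (isCompact_glInt 3 (w.1.adicCompletion L)).mul (isCompact_singleton.mul (isCompact_glInt 3 (w.1.adicCompletion L)))
  have hDo : IsOpen D := (IsOpen.mul_left (isOpen_glInt 3 (w.1.adicCompletion L))).mul_left
  have hDinv : ∀ ⦃k₁ k₂ x : GL (Fin 3) (w.1.adicCompletion L)⦄, k₁ ∈ K₃ → k₂ ∈ K₃ → x ∈ D → k₁ * x * k₂ ∈ D := by
    rintro k₁ k₂ x hk₁ hk₂ ⟨a, ha, y, ⟨m, hm, b, hb, rfl⟩, rfl⟩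
    refine ⟨k₁ * a, Subgroup.mul_mem _ hk₁ ha, m * (b * k₂), ⟨m, hm, b * k₂, Subgroup.mul_mem _ hb hk₂, rfl⟩, ?_⟩
    simp only [mul_assoc]
  have hmD : ∀ u : GL (Fin 3) (w.1.adicCompletion L), u ∈ K₃ → m₀ * u ∈ D := fun u hu =>
    ⟨1, Subgroup.one_mem _, m₀ * u, ⟨m₀, Set.mem_singleton _, u, hu, rfl⟩, one_mul _⟩
  -- (2) the `U`-slice `T = {u | m_z u ∈ D}`: compact, of `μ_U`-mass `≥ 1`
  set T : Set ↥(unipotentRadicalGL (w.1.adicCompletion L) (Zelevinsky1980.lastBlockLabel 3)) :=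
    ((↑) : ↥(unipotentRadicalGL (w.1.adicCompletion L) (Zelevinsky1980.lastBlockLabel 3)) → GL (Fin 3) (w.1.adicCompletion L)) ⁻¹' (m₀⁻¹ • D) with hT
  have hTiff : ∀ u : ↥(unipotentRadicalGL (w.1.adicCompletion L) (Zelevinsky1980.lastBlockLabel 3)),
      u ∈ T ↔ m₀ * (u : GL (Fin 3) (w.1.adicCompletion L)) ∈ D := fun u => by
    rw [hT, Set.mem_preimage, Set.mem_inv_smul_set_iff, smul_eq_mul]
  have hTc : IsCompact T := hUc.isClosedEmbedding_subtypeVal.isCompact_preimage (hDc.smul m₀⁻¹)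
  have hTm : MeasurableSet T := hTc.isClosed.measurableSet
  have hT1 : 1 ≤ μU T := by
    have h1 : μU (unipotentIntPositiveCompacts (w.1.adicCompletion L)) = 1 := by rw [hμU]; exact haarMeasure_self
    rw [← h1]
    exact measure_mono fun u hu => (hTiff u).2 (hmD _ hu)
  have hTt : μU T ≠ ⊤ := hTc.measure_lt_top.ne
  have hTreal : μU.real T ≠ 0 := by
    rw [measureReal_def]
    exact ENNReal.toReal_ne_zero.2 ⟨(lt_of_lt_of_le one_pos hT1).ne', hTt⟩
  -- (3) the test function `f = 1_D ∘ e′`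
  set e' := localSplitEquiv (IsCMField.complexConj L) H' (IsCMField.complexConj_ne_one L)
      ((map_cmConjRingHom_eq_map_complexConj L H') ▸ hH') w hw (isUnit_placeForm_of_isUnit_det hH'd w.1) with he'
  refine ⟨(e' ⁻¹' D).indicator (fun _ => (1 : ℂ)), ?_, ?_⟩
  · exact isLocSmooth_indicator (hDo.preimage e'.continuous) (hDc.isClosed.preimage e'.continuous) (e'.toHomeomorph.isCompact_preimage.2 hDc)
  -- (4) the value
  rw [cmSplitTransfer_apply, cmConstantTermSplit_apply]
  have hint : (fun q : ↥(glInt 3 (w.1.adicCompletion L)) × ↥(unipotentRadicalGL (w.1.adicCompletion L) (Zelevinsky1980.lastBlockLabel 3)) =>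
      (e' ⁻¹' D).indicator (fun _ => (1 : ℂ)) (e'.symm ((q.1 : GL (Fin 3) (w.1.adicCompletion L)) * (m₀ * (q.2 : GL (Fin 3) (w.1.adicCompletion L))) *
        (q.1 : GL (Fin 3) (w.1.adicCompletion L))⁻¹))) = fun q => T.indicator (fun _ => (1 : ℂ)) q.2 := by
    funext q
    have hq1 : (q.1 : GL (Fin 3) (w.1.adicCompletion L)) ∈ K₃ := q.1.2
    by_cases hq : m₀ * (q.2 : GL (Fin 3) (w.1.adicCompletion L)) ∈ D
    · rw [Set.indicator_of_mem ((hTiff q.2).2 hq), Set.indicator_of_mem]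
      rw [Set.mem_preimage, ContinuousMulEquiv.apply_symm_apply]
      exact hDinv hq1 (Subgroup.inv_mem _ hq1) hq
    · rw [Set.indicator_of_notMem (fun h => hq ((hTiff q.2).1 h)), Set.indicator_of_notMem]
      rw [Set.mem_preimage, ContinuousMulEquiv.apply_symm_apply]
      intro h
      apply hq
      have h' := hDinv (Subgroup.inv_mem _ hq1) hq1 h
      simpa only [mul_assoc, inv_mul_cancel_left, inv_mul_cancel, mul_one] using h'
  rw [hKU, hint, integral_fun_snd, integral_indicator_const _ hTm, measureReal_def, hκ1, ENNReal.toReal_one, one_smul, Complex.real_smul, mul_one]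
  exact mul_ne_zero (mul_ne_zero (Complex.ofReal_ne_zero.2 (prefactor_ne_zero L H' hH' hH'd v w hw νH νG)) (Units.ne_zero _))
    (mul_ne_zero (Units.ne_zero _) (Complex.ofReal_ne_zero.2 hTreal))

end Value

/-! ## §3  The socket's frame: #7R at every SPLIT place -/

section Frame

variable (L : Type) [Field L] [NumberField L] [IsCMField L]

variable (H' : Matrix (Fin 3) (Fin 3) L) (Tinf : ArchTransferFactor L H')
    -- σ-algebras of the `G′` side (★ (O10-c5) block), of `H_v`, `G_∞`, `H_∞`, and the Haar data — EXACTLY ★ `SingularEllipticTransfer`'s binders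
    [∀ γ : UnitaryGroup.arch (↥(maximalRealSubfield L)) L (IsCMField.complexConj L) 3 H',
      MeasurableSpace (UnitaryGroup.arch (↥(maximalRealSubfield L)) L (IsCMField.complexConj L) 3 H' ⧸ Subgroup.centralizer ({γ} : Set (UnitaryGroup.arch (↥(maximalRealSubfield L)) L (IsCMField.complexConj L) 3 H')))]
    [∀ γ : UnitaryGroup.arch (↥(maximalRealSubfield L)) L (IsCMField.complexConj L) 3 H',
      BorelSpace (UnitaryGroup.arch (↥(maximalRealSubfield L)) L (IsCMField.complexConj L) 3 H' ⧸ Subgroup.centralizer ({γ} : Set (UnitaryGroup.arch (↥(maximalRealSubfield L)) L (IsCMField.complexConj L) 3 H')))]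
    [∀ (v : HeightOneSpectrum (𝓞 ↥(maximalRealSubfield L))) (γ : (UnitaryGroup.cmDatum L 3 H').Local v),
      MeasurableSpace ((UnitaryGroup.cmDatum L 3 H').Local v ⧸ Subgroup.centralizer ({γ} : Set ((UnitaryGroup.cmDatum L 3 H').Local v)))]
    [∀ (v : HeightOneSpectrum (𝓞 ↥(maximalRealSubfield L))) (γ : (UnitaryGroup.cmDatum L 3 H').Local v),
      BorelSpace ((UnitaryGroup.cmDatum L 3 H').Local v ⧸ Subgroup.centralizer ({γ} : Set ((UnitaryGroup.cmDatum L 3 H').Local v)))]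
    [∀ v : HeightOneSpectrum (𝓞 ↥(maximalRealSubfield L)), MeasurableSpace ((UnitaryGroup.cmDatum L 3 H').Local v)] [∀ v : HeightOneSpectrum (𝓞 ↥(maximalRealSubfield L)), BorelSpace ((UnitaryGroup.cmDatum L 3 H').Local v)]
    [MeasurableSpace (UnitaryGroup.arch (↥(maximalRealSubfield L)) L (IsCMField.complexConj L) 3 H')] [BorelSpace (UnitaryGroup.arch (↥(maximalRealSubfield L)) L (IsCMField.complexConj L) 3 H')]
    [∀ v : HeightOneSpectrum (𝓞 ↥(maximalRealSubfield L)), MeasurableSpace ((UnitaryGroup.cmDatum L 2 (Matrix.of fun i j : Fin 2 => if i.val + j.val + 1 = 2 then (1 : L) else 0)).Local v ×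
        (UnitaryGroup.cmDatum L 1 (Matrix.of fun i j : Fin 1 => if i.val + j.val + 1 = 1 then (1 : L) else 0)).Local v)]
    [∀ v : HeightOneSpectrum (𝓞 ↥(maximalRealSubfield L)), BorelSpace ((UnitaryGroup.cmDatum L 2 (Matrix.of fun i j : Fin 2 => if i.val + j.val + 1 = 2 then (1 : L) else 0)).Local v ×
        (UnitaryGroup.cmDatum L 1 (Matrix.of fun i j : Fin 1 => if i.val + j.val + 1 = 1 then (1 : L) else 0)).Local v)]
    [∀ (v : HeightOneSpectrum (𝓞 ↥(maximalRealSubfield L))) (a : ((UnitaryGroup.cmDatum L 2 (Matrix.of fun i j : Fin 2 => if i.val + j.val + 1 = 2 then (1 : L) else 0)).Local v ×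
        (UnitaryGroup.cmDatum L 1 (Matrix.of fun i j : Fin 1 => if i.val + j.val + 1 = 1 then (1 : L) else 0)).Local v)),
      MeasurableSpace (((UnitaryGroup.cmDatum L 2 (Matrix.of fun i j : Fin 2 => if i.val + j.val + 1 = 2 then (1 : L) else 0)).Local v ×
        (UnitaryGroup.cmDatum L 1 (Matrix.of fun i j : Fin 1 => if i.val + j.val + 1 = 1 then (1 : L) else 0)).Local v) ⧸ Subgroup.centralizer ({a} : Set ((UnitaryGroup.cmDatum L 2 (Matrix.of fun i j : Fin 2 => if i.val + j.val + 1 = 2 then (1 : L) else 0)).Local v ×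
        (UnitaryGroup.cmDatum L 1 (Matrix.of fun i j : Fin 1 => if i.val + j.val + 1 = 1 then (1 : L) else 0)).Local v)))]
    [∀ (v : HeightOneSpectrum (𝓞 ↥(maximalRealSubfield L))) (a : ((UnitaryGroup.cmDatum L 2 (Matrix.of fun i j : Fin 2 => if i.val + j.val + 1 = 2 then (1 : L) else 0)).Local v ×
        (UnitaryGroup.cmDatum L 1 (Matrix.of fun i j : Fin 1 => if i.val + j.val + 1 = 1 then (1 : L) else 0)).Local v)),
      BorelSpace (((UnitaryGroup.cmDatum L 2 (Matrix.of fun i j : Fin 2 => if i.val + j.val + 1 = 2 then (1 : L) else 0)).Local v ×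
        (UnitaryGroup.cmDatum L 1 (Matrix.of fun i j : Fin 1 => if i.val + j.val + 1 = 1 then (1 : L) else 0)).Local v) ⧸ Subgroup.centralizer ({a} : Set ((UnitaryGroup.cmDatum L 2 (Matrix.of fun i j : Fin 2 => if i.val + j.val + 1 = 2 then (1 : L) else 0)).Local v ×
        (UnitaryGroup.cmDatum L 1 (Matrix.of fun i j : Fin 1 => if i.val + j.val + 1 = 1 then (1 : L) else 0)).Local v)))]
    [MeasurableSpace (UnitaryGroup.arch (↥(maximalRealSubfield L)) L (IsCMField.complexConj L) 3 (Matrix.of fun i j : Fin 3 => if i.val + j.val + 1 = 3 then (1 : L) else 0))] [BorelSpace (UnitaryGroup.arch (↥(maximalRealSubfield L)) L (IsCMField.complexConj L) 3 (Matrix.of fun i j : Fin 3 => if i.val + j.val + 1 = 3 then (1 : L) else 0))]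
    [∀ γ : UnitaryGroup.arch (↥(maximalRealSubfield L)) L (IsCMField.complexConj L) 3 (Matrix.of fun i j : Fin 3 => if i.val + j.val + 1 = 3 then (1 : L) else 0),
      MeasurableSpace (UnitaryGroup.arch (↥(maximalRealSubfield L)) L (IsCMField.complexConj L) 3 (Matrix.of fun i j : Fin 3 => if i.val + j.val + 1 = 3 then (1 : L) else 0) ⧸ Subgroup.centralizer ({γ} : Set (UnitaryGroup.arch (↥(maximalRealSubfield L)) L (IsCMField.complexConj L) 3 (Matrix.of fun i j : Fin 3 => if i.val + j.val + 1 = 3 then (1 : L) else 0))))]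
    [∀ γ : UnitaryGroup.arch (↥(maximalRealSubfield L)) L (IsCMField.complexConj L) 3 (Matrix.of fun i j : Fin 3 => if i.val + j.val + 1 = 3 then (1 : L) else 0),
      BorelSpace (UnitaryGroup.arch (↥(maximalRealSubfield L)) L (IsCMField.complexConj L) 3 (Matrix.of fun i j : Fin 3 => if i.val + j.val + 1 = 3 then (1 : L) else 0) ⧸ Subgroup.centralizer ({γ} : Set (UnitaryGroup.arch (↥(maximalRealSubfield L)) L (IsCMField.complexConj L) 3 (Matrix.of fun i j : Fin 3 => if i.val + j.val + 1 = 3 then (1 : L) else 0))))]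
    [MeasurableSpace (UnitaryGroup.arch (↥(maximalRealSubfield L)) L (IsCMField.complexConj L) 2 (Matrix.of fun i j : Fin 2 => if i.val + j.val + 1 = 2 then (1 : L) else 0) ×
          UnitaryGroup.arch (↥(maximalRealSubfield L)) L (IsCMField.complexConj L) 1 (Matrix.of fun i j : Fin 1 => if i.val + j.val + 1 = 1 then (1 : L) else 0))]
    [BorelSpace (UnitaryGroup.arch (↥(maximalRealSubfield L)) L (IsCMField.complexConj L) 2 (Matrix.of fun i j : Fin 2 => if i.val + j.val + 1 = 2 then (1 : L) else 0) ×
          UnitaryGroup.arch (↥(maximalRealSubfield L)) L (IsCMField.complexConj L) 1 (Matrix.of fun i j : Fin 1 => if i.val + j.val + 1 = 1 then (1 : L) else 0))]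
    [∀ a : (UnitaryGroup.arch (↥(maximalRealSubfield L)) L (IsCMField.complexConj L) 2 (Matrix.of fun i j : Fin 2 => if i.val + j.val + 1 = 2 then (1 : L) else 0) ×
          UnitaryGroup.arch (↥(maximalRealSubfield L)) L (IsCMField.complexConj L) 1 (Matrix.of fun i j : Fin 1 => if i.val + j.val + 1 = 1 then (1 : L) else 0)),
      MeasurableSpace ((UnitaryGroup.arch (↥(maximalRealSubfield L)) L (IsCMField.complexConj L) 2 (Matrix.of fun i j : Fin 2 => if i.val + j.val + 1 = 2 then (1 : L) else 0) ×
          UnitaryGroup.arch (↥(maximalRealSubfield L)) L (IsCMField.complexConj L) 1 (Matrix.of fun i j : Fin 1 => if i.val + j.val + 1 = 1 then (1 : L) else 0)) ⧸ Subgroup.centralizer ({a} : Set (UnitaryGroup.arch (↥(maximalRealSubfield L)) L (IsCMField.complexConj L) 2 (Matrix.of fun i j : Fin 2 => if i.val + j.val + 1 = 2 then (1 : L) else 0) ×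
          UnitaryGroup.arch (↥(maximalRealSubfield L)) L (IsCMField.complexConj L) 1 (Matrix.of fun i j : Fin 1 => if i.val + j.val + 1 = 1 then (1 : L) else 0))))]
    [∀ a : (UnitaryGroup.arch (↥(maximalRealSubfield L)) L (IsCMField.complexConj L) 2 (Matrix.of fun i j : Fin 2 => if i.val + j.val + 1 = 2 then (1 : L) else 0) ×
          UnitaryGroup.arch (↥(maximalRealSubfield L)) L (IsCMField.complexConj L) 1 (Matrix.of fun i j : Fin 1 => if i.val + j.val + 1 = 1 then (1 : L) else 0)),
      BorelSpace ((UnitaryGroup.arch (↥(maximalRealSubfield L)) L (IsCMField.complexConj L) 2 (Matrix.of fun i j : Fin 2 => if i.val + j.val + 1 = 2 then (1 : L) else 0) ×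
          UnitaryGroup.arch (↥(maximalRealSubfield L)) L (IsCMField.complexConj L) 1 (Matrix.of fun i j : Fin 1 => if i.val + j.val + 1 = 1 then (1 : L) else 0)) ⧸ Subgroup.centralizer ({a} : Set (UnitaryGroup.arch (↥(maximalRealSubfield L)) L (IsCMField.complexConj L) 2 (Matrix.of fun i j : Fin 2 => if i.val + j.val + 1 = 2 then (1 : L) else 0) ×
          UnitaryGroup.arch (↥(maximalRealSubfield L)) L (IsCMField.complexConj L) 1 (Matrix.of fun i j : Fin 1 => if i.val + j.val + 1 = 1 then (1 : L) else 0))))]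
    (νH : ∀ v : HeightOneSpectrum (𝓞 ↥(maximalRealSubfield L)), Measure ((UnitaryGroup.cmDatum L 2 (Matrix.of fun i j : Fin 2 => if i.val + j.val + 1 = 2 then (1 : L) else 0)).Local v ×
        (UnitaryGroup.cmDatum L 1 (Matrix.of fun i j : Fin 1 => if i.val + j.val + 1 = 1 then (1 : L) else 0)).Local v))
    (νG : ∀ v : HeightOneSpectrum (𝓞 ↥(maximalRealSubfield L)), Measure ((UnitaryGroup.cmDatum L 3 H').Local v))
    [∀ v, IsFiniteMeasureOnCompacts (νH v)] [∀ v, (νH v).IsMulRightInvariant]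
    [∀ v, (νG v).IsHaarMeasure] [∀ v, (νG v).IsMulRightInvariant]  -- MAIN-b's strength (F2): `νG_v` Haar
    (νGi : Measure (UnitaryGroup.arch (↥(maximalRealSubfield L)) L (IsCMField.complexConj L) 3 H')) (νqi : Measure (UnitaryGroup.arch (↥(maximalRealSubfield L)) L (IsCMField.complexConj L) 3 (Matrix.of fun i j : Fin 3 => if i.val + j.val + 1 = 3 then (1 : L) else 0)))
    (νHi : Measure (UnitaryGroup.arch (↥(maximalRealSubfield L)) L (IsCMField.complexConj L) 2 (Matrix.of fun i j : Fin 2 => if i.val + j.val + 1 = 2 then (1 : L) else 0) ×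
          UnitaryGroup.arch (↥(maximalRealSubfield L)) L (IsCMField.complexConj L) 1 (Matrix.of fun i j : Fin 1 => if i.val + j.val + 1 = 1 then (1 : L) else 0)))
    [IsFiniteMeasureOnCompacts νGi] [νGi.IsMulRightInvariant] [IsFiniteMeasureOnCompacts νqi] [νqi.IsMulRightInvariant]
    [IsFiniteMeasureOnCompacts νHi] [νHi.IsMulRightInvariant]


/-- **`sig_K2E3GermConstantRegularHR` at every SPLIT place, binders token for token.**  At a finite place `v` of `L⁺` with two places of `L` above it
(`¬ Subsingleton (PlacesOver L v)`), for the PINNED factor `Δ = Δ‴` and the canonical families `(mH v, mG v)` of `hCTM`, the named split transfer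
`f^H := cmSplitTransfer … f` of the test function `f` of §2 is a smooth `Δ‴_v`-transfer pair (★ `isLocalDeltaTransfer_cmSplitTransfer`, [Rogawski1990, Lemma 4.13.1 (a)];
`νH v` is a Haar measure because `H_v` is unimodular (★ `K2E4WeakMatrixAlmostEverywhereAgreement.isMulRightInvariant_endoscopicLocal`) and `νH v ≠ 0` under `hCTM` (a canonical
member at a `G`-regular class — ★ `exists_isGRegular_isNormPair` supplies one — is non-zero by admissibility), ★ `isHaarMeasure_of_isMulRightInvariant_of_ne_zero`) and charges
`γ_{H,v}` (§2).  Places in `S_bad` included. [cite: Rogawski1990, §4.13 Lemma 4.13.1 (a) pp. 64–66; §4.9 Prop. 4.9.1 (a) p. 55; §8.2 Prop. 8.2.1 (a) p. 118] -/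
theorem germConstantRegularHR_of_not_subsingleton :
        ∀ (hK : ∀ v : HeightOneSpectrum (𝓞 ↥(maximalRealSubfield L)), νG v (UnitaryGroup.cmLocalIntegralLevel L 3 H' v : Set ((UnitaryGroup.cmDatum L 3 H').Local v)) = 1)
          (hanis : ∀ x : Fin 3 → L, hermForm (cmConjRingHom L) H' x x = 0 → x = 0)
          (Sbad : Finset (HeightOneSpectrum (𝓞 ↥(maximalRealSubfield L))))
              (Δ : ∀ v : HeightOneSpectrum (𝓞 ↥(maximalRealSubfield L)), LocalTransferFactor L H' v)
              (mH : ∀ v : HeightOneSpectrum (𝓞 ↥(maximalRealSubfield L)),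
                OrbitalMeasureFamily ((UnitaryGroup.cmDatum L 2 (Matrix.of fun i j : Fin 2 => if i.val + j.val + 1 = 2 then (1 : L) else 0)).Local v ×
                  (UnitaryGroup.cmDatum L 1 (Matrix.of fun i j : Fin 1 => if i.val + j.val + 1 = 1 then (1 : L) else 0)).Local v))
              (mG : ∀ v : HeightOneSpectrum (𝓞 ↥(maximalRealSubfield L)), OrbitalMeasureFamily ((UnitaryGroup.cmDatum L 3 H').Local v))
          (m' : OrbitalMeasureFamily (UnitaryGroup.arch (↥(maximalRealSubfield L)) L (IsCMField.complexConj L) 3 H'))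
                (m : OrbitalMeasureFamily (UnitaryGroup.arch (↥(maximalRealSubfield L)) L (IsCMField.complexConj L) 3
                  (Matrix.of fun i j : Fin 3 => if i.val + j.val + 1 = 3 then (1 : L) else 0)))
                (mHi : OrbitalMeasureFamily (UnitaryGroup.arch (↥(maximalRealSubfield L)) L (IsCMField.complexConj L) 2
                    (Matrix.of fun i j : Fin 2 => if i.val + j.val + 1 = 2 then (1 : L) else 0) ×
                  UnitaryGroup.arch (↥(maximalRealSubfield L)) L (IsCMField.complexConj L) 1
                    (Matrix.of fun i j : Fin 1 => if i.val + j.val + 1 = 1 then (1 : L) else 0)))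
                (t' : ∀ γ' : UnitaryGroup.arch (↥(maximalRealSubfield L)) L (IsCMField.complexConj L) 3 H',
                  Measure (Subgroup.centralizer ({γ'} : Set (UnitaryGroup.arch (↥(maximalRealSubfield L)) L (IsCMField.complexConj L) 3 H'))))
                (t : ∀ γ : UnitaryGroup.arch (↥(maximalRealSubfield L)) L (IsCMField.complexConj L) 3
                    (Matrix.of fun i j : Fin 3 => if i.val + j.val + 1 = 3 then (1 : L) else 0),
                  Measure (Subgroup.centralizer ({γ} : Set (UnitaryGroup.arch (↥(maximalRealSubfield L)) L (IsCMField.complexConj L) 3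
                    (Matrix.of fun i j : Fin 3 => if i.val + j.val + 1 = 3 then (1 : L) else 0)))))
                (tH : ∀ γH : UnitaryGroup.arch (↥(maximalRealSubfield L)) L (IsCMField.complexConj L) 2
                      (Matrix.of fun i j : Fin 2 => if i.val + j.val + 1 = 2 then (1 : L) else 0) ×
                    UnitaryGroup.arch (↥(maximalRealSubfield L)) L (IsCMField.complexConj L) 1
                      (Matrix.of fun i j : Fin 1 => if i.val + j.val + 1 = 1 then (1 : L) else 0),
                  Measure (Subgroup.centralizer ({γH} : Set (UnitaryGroup.arch (↥(maximalRealSubfield L)) L (IsCMField.complexConj L) 2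
                      (Matrix.of fun i j : Fin 2 => if i.val + j.val + 1 = 2 then (1 : L) else 0) ×
                    UnitaryGroup.arch (↥(maximalRealSubfield L)) L (IsCMField.complexConj L) 1
                      (Matrix.of fun i j : Fin 1 => if i.val + j.val + 1 = 1 then (1 : L) else 0)))))
            (hherm : (H'.map (cmConjRingHom L)).transpose = H')
            (hCTM : CanonicalTransferMatrix L H' Tinf.Δ νH νG Sbad Δ mH mG)
            (hACS : ArchCanonicalSingularMatrix L H' Tinf νGi νqi νHi hanis m' m mHi t' t tH),
    ∀ (μ : Literature.NumberTheory.GaloisRepresentations.HeckeCharacter L) (hμu : μ.IsUnitary)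
      (hμω : ∀ x : Literature.NumberTheory.GaloisRepresentations.ideleGroup ↥(maximalRealSubfield L),
        μ (AdeleRing.ideleBaseChange (↥(maximalRealSubfield L)) L x) = quadraticHeckeCharCM L x)
      (hΔ : Δ = finExplicitCollection L H' μ (finExplicitDelta_conj_left_all L H' μ) (finExplicitDelta_conj_right_all L H' μ))
      (hTinf : Tinf = archCanonicalTransferFactor L H' μ),
              ∀ (γ₀ : (UnitaryGroup.cmDatum L 3 H').Rational) (e₁ e₂ : L), e₁ ≠ e₂ →
                ((((γ₀ : unitaryGroup (cmConjRingHom L) H').val : GL (Fin 3) L) : Matrix (Fin 3) (Fin 3) L) - e₁ • (1 : Matrix (Fin 3) (Fin 3) L)) * ((((γ₀ : unitaryGroup (cmConjRingHom L) H').val : GL (Fin 3) L) : Matrix (Fin 3) (Fin 3) L) - e₂ • (1 : Matrix (Fin 3) (Fin 3) L)) = 0 →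
                (¬ ∃ ζ : L, (((γ₀ : unitaryGroup (cmConjRingHom L) H').val : GL (Fin 3) L) : Matrix (Fin 3) (Fin 3) L) = ζ • (1 : Matrix (Fin 3) (Fin 3) L)) →
                (((γ₀ : unitaryGroup (cmConjRingHom L) H').val : GL (Fin 3) L) : Matrix (Fin 3) (Fin 3) L).charpoly =
                  (Polynomial.X - Polynomial.C e₁) ^ 2 * (Polynomial.X - Polynomial.C e₂) →
                ∀ (γH : (UnitaryGroup.cmDatum L 2 (Matrix.of fun i j : Fin 2 => if i.val + j.val + 1 = 2 then (1 : L) else 0)).Rational ×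
                    (UnitaryGroup.cmDatum L 1 (Matrix.of fun i j : Fin 1 => if i.val + j.val + 1 = 1 then (1 : L) else 0)).Rational),
                  (((γH.1 : unitaryGroup (cmConjRingHom L) (Matrix.of fun i j : Fin 2 => if i.val + j.val + 1 = 2 then (1 : L) else 0)).val : GL (Fin 2) L) : Matrix (Fin 2) (Fin 2) L) =
                    e₁ • (1 : Matrix (Fin 2) (Fin 2) L) →
                  (((γH.2 : unitaryGroup (cmConjRingHom L) (Matrix.of fun i j : Fin 1 => if i.val + j.val + 1 = 1 then (1 : L) else 0)).val : GL (Fin 1) L) : Matrix (Fin 1) (Fin 1) L) 0 0 = e₂ →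
                  ∀ (v : HeightOneSpectrum (𝓞 ↥(maximalRealSubfield L))), ¬ Subsingleton (UnitaryGroup.PlacesOver L v) →
                  ∃ (fH : (UnitaryGroup.cmDatum L 2 (Matrix.of fun i j : Fin 2 => if i.val + j.val + 1 = 2 then (1 : L) else 0)).Local v × (UnitaryGroup.cmDatum L 1 (Matrix.of fun i j : Fin 1 => if i.val + j.val + 1 = 1 then (1 : L) else 0)).Local v → ℂ) (f : (UnitaryGroup.cmDatum L 3 H').Local v → ℂ),
                    IsLocSmooth f ∧ IsLocSmooth fH ∧ IsLocalDeltaTransfer L H' v (Δ v) (mH v) (mG v) fH f ∧ fH ((UnitaryGroup.cmDatum L 2 (Matrix.of fun i j : Fin 2 => if i.val + j.val + 1 = 2 then (1 : L) else 0)).toLocal v ((UnitaryGroup.cmDatum L 2 (Matrix.of fun i j : Fin 2 => if i.val + j.val + 1 = 2 then (1 : L) else 0)).toAdelic γH.1),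
                            (UnitaryGroup.cmDatum L 1 (Matrix.of fun i j : Fin 1 => if i.val + j.val + 1 = 1 then (1 : L) else 0)).toLocal v ((UnitaryGroup.cmDatum L 1 (Matrix.of fun i j : Fin 1 => if i.val + j.val + 1 = 1 then (1 : L) else 0)).toAdelic γH.2)) ≠ 0 := by
  intro _ hanis Sbad Δ mH mG _ _ _ _ _ _ hherm hCTM _ μ _ hμω hΔ _ _ _ _ _ _ _ _ γH _ _ v hns
  classical
  -- (1) a split witness `w ∣ v`, `c • w ≠ w`
  obtain ⟨w, hw⟩ : ∃ w : UnitaryGroup.PlacesOver L v, IsCMField.complexConj L • w.1 ≠ w.1 := by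
    by_contra h
    obtain ⟨w⟩ := UnitaryGroup.PlacesOver.nonempty L v
    exact hns (UnitaryGroup.PlacesOver.subsingleton_of_smul_eq (IsCMField.complexConj L) (IsCMField.complexConj_ne_one L) w
      (not_not.1 fun hw => h ⟨w, hw⟩))
  -- (2) `νH v` is a Haar measure: unimodularity of `H_v` + `νH v ≠ 0` (admissibility of the canonical member at a `G`-regular class)
  have hne : νH v ≠ 0 := by
    intro hv0
    obtain ⟨γH', -, hreg', -⟩ := K2E4WeakMatrixAlmostEverywhereAgreement.exists_isGRegular_isNormPair (L := L) H' hherm hanis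
    have hP := isLocalGRegular_out_mk_rationalComponent L γH' hreg' v
    obtain ⟨t, ht, hti, -, hm⟩ := (hCTM.1 v).2.2.1 _ hP
    have hz := ((hCTM.1 v).1.2.1 _ hP).1
    rw [hm] at hz
    exact hz (quotientMeasure_eq_zero_of_eq_zero _ _ t (νH v) hv0)
  haveI : (νH v).IsHaarMeasure := by
    haveI := K2E4WeakMatrixAlmostEverywhereAgreement.isMulRightInvariant_endoscopicLocal L v (MeasureTheory.Measure.haar : Measure ((UnitaryGroup.cmDatum L 2 (Matrix.of fun i j : Fin 2 => if i.val + j.val + 1 = 2 then (1 : L) else 0)).Local v × (UnitaryGroup.cmDatum L 1 (Matrix.of fun i j : Fin 1 => if i.val + j.val + 1 = 1 then (1 : L) else 0)).Local v))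
    exact isHaarMeasure_of_isMulRightInvariant_of_ne_zero MeasureTheory.Measure.haar (νH v) hne
  -- (3) the explicit factor, the named transfer, the charged test function
  subst hΔ
  have hH'd : IsUnit H'.det := isUnit_iff_ne_zero.mpr (Godement.det_ne_zero_of_anisotropic L H' hanis)
  letI : MeasurableSpace (w.1.adicCompletion L) := borel _
  haveI : BorelSpace (w.1.adicCompletion L) := ⟨rfl⟩
  obtain ⟨f, hf, hval⟩ := exists_isLocSmooth_cmSplitTransfer_apply_ne_zero L H' hherm hH'd v w hw (νH v) (νG v) μ
    ((UnitaryGroup.cmDatum L 2 (Matrix.of fun i j : Fin 2 => if i.val + j.val + 1 = 2 then (1 : L) else 0)).toLocal v ((UnitaryGroup.cmDatum L 2 (Matrix.of fun i j : Fin 2 => if i.val + j.val + 1 = 2 then (1 : L) else 0)).toAdelic γH.1),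
      (UnitaryGroup.cmDatum L 1 (Matrix.of fun i j : Fin 1 => if i.val + j.val + 1 = 1 then (1 : L) else 0)).toLocal v ((UnitaryGroup.cmDatum L 1 (Matrix.of fun i j : Fin 1 => if i.val + j.val + 1 = 1 then (1 : L) else 0)).toAdelic γH.2))
  have hΦ₂d : (Matrix.of fun i j : Fin 2 => if i.val + j.val + 1 = 2 then (1 : L) else 0).det ≠ 0 := (UnitaryGroup.isUnit_antidiagOne_det L 2).ne_zero
  have hΦ₁d : (Matrix.of fun i j : Fin 1 => if i.val + j.val + 1 = 1 then (1 : L) else 0).det ≠ 0 := (UnitaryGroup.isUnit_antidiagOne_det L 1).ne_zero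
  have htr := isLocalDeltaTransfer_cmSplitTransfer L H' (IsCMField.complexConj_ne_one L) w hw
    (UnitaryGroup.antidiagOne_map_transpose (IsCMField.complexConj L) 2) (UnitaryGroup.isUnit_placeForm_antidiagOne (E := L) 2 w.1)
    (UnitaryGroup.antidiagOne_map_transpose (IsCMField.complexConj L) 1) (UnitaryGroup.isUnit_placeForm_antidiagOne (E := L) 1 w.1)
    ((UnitaryGroup.map_cmConjRingHom_eq_map_complexConj L H') ▸ hherm) (UnitaryGroup.isUnit_placeForm_of_isUnit_det hH'd w.1)
    (UnitaryGroup.antidiagOne_isHermitian L 2) hΦ₂d (UnitaryGroup.antidiagOne_isHermitian L 1) hΦ₁d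
    μ (finExplicitDelta_conj_left_all L H' μ) (finExplicitDelta_conj_right_all L H' μ)
    (HeckeCharacter.galConj_eq_inv_of_restrict_eq_quadraticHeckeCharCM L μ hμω) (νH v) (νG v) (mH v) (mG v) (hCTM.1 v).2.2.1 (hCTM.1 v).2.2.2
    hherm hH'd f hf
  exact ⟨_, f, hf, htr.1, htr.2, hval⟩

end Frame

end Summit.HodgeConjecture.HodgeConjecture.Cruxes.H413.K2E3GermConstantRegularHRSplit

end
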